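import Literature.Geometry.Kaehler.ComplexTorusFourierWeylOperator
import Literature.Geometry.Kaehler.GradedFormsLefschetzStrings
import Literature.Geometry.Kaehler.ComplexTorusLefschetzDual
import Literature.Algebra.Lie.LefschetzModuleLowestWeightVectors
import HarnessLib

/-!
# The Fourier transform on the `𝔰𝔩₂`-string of a primitive class: `w(η^{∧q}/q! ∧ α) = (−η)^{∧r}/r! ∧ α` and
# `φ^*F(η^{∧q}/q! ∧ α) = (−1)^g χ(d) · (−η)^{∧r}/r! ∧ α` for `α` primitive of degree `k`, `q + r = g − k`
# (Beauville 2010, §5 Corollary: "`ℱ(θ^q/q! · z) = ((−θ)^r/r!) z`, with `r = g + s − 2p − q`")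

Layer `Literature/Geometry/Kaehler`, namespace `Literature.Geometry.Kaehler.ComplexTorus`; lane `lit-hodgefound` (Track 2 foundations
library), prover seat `lit-hodgefound-p09` (generation 52, row g52-#2). THEOREMS ONLY (no definition, no named fact, no instance, no
notation; D-0026 net debt `0`). Sequel of rows g51-#4 `ComplexTorusFourierWeylOperator` (`φ^* ∘ F = (−1)^g χ(d) · w` on `H•(X; ℂ)`),
g21-#4 `GradedFormsLefschetzStrings` (the `𝔰𝔩₂`-string `α, Lα, …, L^{g−k}α` of a primitive form) and of the abstract row g31-#1
`Algebra/Lie/LefschetzModuleWeylOperator` (`w (eʲ p) = (−1)^{k+j} (j!/(k−j)!) e^{k−j} p` on a string of a lowest-weight vector `p ∈ P_{−k}`).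

SETTING. `X = E/Φ(ℤ^ι)` a complex torus of dimension `g = dim_ℂ E`, `η` a non-degenerate real `2`-form with Lefschetz `𝔰𝔩₂`-triple
`(L_η, Λ_η, H)` on `H•(X; ℂ) = GForm E ℂ` (`lefschetzG`, `lefschetzDualG`, `countingG`; `Hᵏ = M_{k−g}`), `w` its Weyl operator
(`(hasLefschetzProperty_lefschetzG hη).weylOperator isZGrading_countingG`), `Pᵏ(η) = primitiveForms η k` Lange's/Voisin's primitive
forms (`ker L^{g−k+1}` on `⋀ᵏ`, `k ≤ g`; `= ker Λ_η` by Voisin's Lemma 6.24, `mem_primitiveForms_iff_lefschetzDual_eq_zero`),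
`P_{−n} = HasLefschetzProperty.primitiveSpace (countingG E) (lefschetzG η) n` the abstract lowest-weight space of weight `−n`
(row A1-88), `Lʲ = lefschetzPow η j` (`η^{∧j} ∧ ·` with explicit target degree). For a Riemann form `η` of type `d = (d₁, …, d_g)`:
`F = fourierForm Φ e` the cohomological Fourier transform (Lange (6.11)), `φ` any real-linear `V → Ω̄` with `Im φ(u)(w) = η(u, w)`
(e.g. `φ_H = phiHRep`), `χ(d) = d₁⋯d_g`.

## What is proved

* §1 THE BRIDGE (Beauville: "We say that `z` is primitive if `θ^{g−1} ∗ z = 0` [`Yz = 0`]. The primitive elements are exactly the lowest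
  weight elements"): `of_mem_primitiveSpace_of_mem_primitiveForms` / **`of_mem_primitiveSpace_iff_mem_primitiveForms`** — for `k ≤ g`,
  `GForm.of k α ∈ P_{−(g−k)} ⟺ α ∈ Pᵏ(η)`; `of_mem_primitiveSpace_iff_lefschetzDualG_eq_zero` (`⟺ Λ_η(of k α) = 0`).
* §2 THE WEYL OPERATOR ON A STRING (`α ∈ Pᵏ(η)`, `k + n = g`, `j + r = n`): **`weylOperator_of_lefschetzPow_of_mem_primitiveForms`:
  `w(Lʲα) = (−1)^{n+j} (j!/r!) · Lʳα`**; **`weylOperator_of_inv_factorial_smul_lefschetzPow`: `w(Lʲα/j!) = (−1)^r · Lʳα/r!`** — Beauville's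
  Corollary for the Weyl element `(0 −1 ; 1 0) ↦ ℱ` ("`ℱ(θ^q/q! z) = (−θ)^r/r! z`"); the ends `weylOperator_of_of_mem_primitiveForms`
  (`w(α) = (−1)^n Lⁿα/n!`) and `weylOperator_of_lefschetzPow_top` (`w(Lⁿα) = n! · α`).
* §3 THE FOURIER TRANSFORM ON A STRING: **`IsPolarizationType.fourierForm_inv_factorial_smul_lefschetzPow_compContinuousLinearMap`:
  `φ^*F(Lʲα/j!) = (−1)^g χ(d) · (−1)^r Lʳα/r!`** as forms of degree `2r + k` (every polarisation type, every such `φ`, every lattice frame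
  `e`), `IsPolarizationType.fourierForm_lefschetzPow_compContinuousLinearMap` (`φ^*F(Lʲα) = (−1)^g χ(d) (−1)^{n+j} (j!/r!) Lʳα`),
  **`IsPolarizationType.fourierForm_compContinuousLinearMap_of_mem_primitiveForms`: `φ^*F(α) = (−1)^k χ(d) · Lⁿα/n!` for a PRIMITIVE class
  `α` of degree `k`** (the Fourier transform of a primitive class is its Lefschetz-dual top, generalising row g50-#2's `F(1) = (−1)^g χ γ̂_g`-type
  statements from `α = 1` to all primitive `α`), and the principal forms `IsPrincipalPolarization.…` with `φ = φ_H`, `χ = 1`.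

## Sources, VERBATIM

* A. Beauville, *The action of SL₂ on abelian varieties*, J. Ramanujan Math. Soc. 25 (2010) [Beauville2010SL2], held text
  `paper:arxiv-0805.1541` p0005–p0006, §5: "We say that an element `z ∈ CH^p_s(A)` is primitive if `θ^{g−1} ∗ z = 0`. The primitive elements
  are exactly the lowest weight elements for the action of `SL₂` on `CH(A)`. Let `z ∈ CH^p_s(A)` be a primitive element. The subspace of
  `CH(A)` spanned (over `ℚ`) by the `θ^q z` is an irreducible representation of `SL₂`; it is identified with the space of polynomials in one
  variable of degree `≤ g+s−2p` […] **Proposition** If `z ∈ CH^p_s(A)` is primitive, we have `g+s−2p ≥ 0`, and `(z, θz, …, θ^{g+s−2p} z)` is a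
  basis of an irreducible subrepresentation of `CH(A)`. […] Since the Fourier automorphism `ℱ` of `CH(A)` is given by the action of `w`, we
  have: **Corollary** Let `z ∈ CH^p_s(A)` be a primitive element, and let `q ≤ g+s−2p`. Then `ℱ(θ^q/q! · z) = ((−θ)^r/r!) z`, with
  `r = g+s−2p−q`."  §4 Theorem: "`(0 −1 ; 1 0)·z = ℱ(z)`".
* A. Polishchuk, *Fourier-stable subrings in the Chow rings of abelian varieties* (2007) [Polishchuk2007FourierStable], §1 Lemma 1.4 (p. 3):
  "`F_d = (1/χ(d)) φ^* ∘ F`", "`(−1)^g F_d = exp(e) exp(−f) exp(e)`" (the tree's `w`; row g51-#4).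
* H. Lange, *Abelian Varieties over the Complex Numbers* (2023) [Lange2023AbelianVarietiesComplex], §6.2.4 (6.11), Prop. 6.2.20 p. 310 (`F`);
  §7.3.2 (the Lefschetz operator `L`, primitive forms `Pᵏ = ker L^{g−k+1}`).
* C. Voisin, *Hodge Theory and Complex Algebraic Geometry I* (2002) [Voisin2002], §6.2.2 Lemma 6.24 ("`α` of degree `k ≤ n` is primitive
  iff `Λα = 0`").
* Y. André, *Pour une théorie inconditionnelle des motifs* (1996) [Andre1996Motifs], §1.2 (p. 11) (`(0 1 ; −1 0) ↦ ± *_H` on strings).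

## Dictionary and signs

Beauville's `z ∈ CH^p_s(A)` of `H`-weight `2p − g − s` is here a form `α ∈ Hᵏ(X; ℂ)` of weight `k − g = −n` (cohomology: `s = 0`, `k = 2p`);
"`θ^{g−1} ∗ z = 0`" is `Λ_η α = 0` (`Y = f = Λ`), i.e. `α ∈ Pᵏ(η)` (§1); `g + s − 2p = n = g − k ≥ 0`; his `ℱ = ρ(w)` is the tree's `w`
(row g51-#9 `IsPolarizationType.sl2Rep_weyl_of`: `ρ(0 −1 ; 1 0) = w = (−1)^g χ(d)⁻¹ φ^*F`), so the Corollary reads `w(Lʲα/j!) = (−1)^r Lʳα/r!`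
EXACTLY (§2), and through `φ^* ∘ F = (−1)^g χ(d) · w` it becomes the statement of §3 for Lange's un-normalised `F`.
-/

noncomputable section

-- `Module ℂ` / `SMulZeroClass ℂ` synthesis on `E [⋀^Fin k]→L[ℝ] ℂ` (as in `ComplexTorusLefschetzDecomposition`)
set_option maxSynthPendingDepth 3

namespace Literature.Geometry.Kaehler

namespace ComplexTorus

open Module Function Finset
open Literature.LinearAlgebra.Alternating Literature.Algebra.Lie

universe uE

/-! ## §1 The bridge: `of k α ∈ P_{−(g−k)}` iff `α ∈ Pᵏ(η)` iff `Λ_η (of k α) = 0` -/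

section Bridge

variable {E : Type uE} [NormedAddCommGroup E] [NormedSpace ℂ E] [FiniteDimensional ℂ E] [Nontrivial E] {η : E [⋀^Fin 2]→L[ℝ] ℝ}

omit [FiniteDimensional ℂ E] [Nontrivial E] in
/-- `of k α ∈ M_{−n}` for `k + n = g` (the degree written as a lowest weight). [cite: Beauville2010SL2, §4 Theorem ("Hz = (2p−g−s) z")] -/
theorem of_mem_degreeSpace_countingG_neg {k n : ℕ} (hkn : k + n = finrank ℂ E) (α : E [⋀^Fin k]→L[ℝ] ℂ) :
    GForm.of k α ∈ degreeSpace (countingG E) (-(n : ℤ)) := by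
  have h := of_mem_degreeSpace_countingG (E := E) k α
  rwa [show (k : ℤ) - (finrank ℂ E : ℤ) = -(n : ℤ) by omega] at h

/-- **`of k α ∈ P_{−n} ⟺ Λ_η(of k α) = 0`** (`k + n = g`): Beauville's "primitive if `θ^{g−1} ∗ z = 0`" — the lowest-weight vectors are the
vectors killed by `f = Λ_η` (abstract row `mem_primitiveSpace_iff_dual_apply_eq_zero`, with the tree's `Λ_η` as the `𝔰𝔩₂`-partner,
`dual_lefschetzG_eq_lefschetzDualG`). [cite: Beauville2010SL2, §5 (p. 6, "The primitive elements are exactly the lowest weight elements")] -/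
theorem of_mem_primitiveSpace_iff_lefschetzDualG_eq_zero (hη : ∀ v : E, v ≠ 0 → ∃ w : E, η ![v, w] ≠ 0) {k n : ℕ}
    (hkn : k + n = finrank ℂ E) (α : E [⋀^Fin k]→L[ℝ] ℂ) :
    GForm.of k α ∈ HasLefschetzProperty.primitiveSpace (countingG E) (lefschetzG η) n ↔ lefschetzDualG η (GForm.of k α) = 0 := by
  rw [(hasLefschetzProperty_lefschetzG hη).mem_primitiveSpace_iff_dual_apply_eq_zero isZGrading_countingG
    (of_mem_degreeSpace_countingG_neg hkn α), dual_lefschetzG_eq_lefschetzDualG hη]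

/-- **A primitive form is a lowest-weight vector: `α ∈ Pᵏ(η)`, `k + n = g` ⇒ `of k α ∈ P_{−n}`** (`Λ_η(of k α) = 0`, row g21-#4
`lefschetzDualG_of_of_mem_primitiveForms`). [cite: Beauville2010SL2, §5 (p. 6)] [cite: Voisin2002, §6.2.2 Lemma 6.24] -/
theorem of_mem_primitiveSpace_of_mem_primitiveForms (hη : ∀ v : E, v ≠ 0 → ∃ w : E, η ![v, w] ≠ 0) {k n : ℕ}
    (hkn : k + n = finrank ℂ E) {α : E [⋀^Fin k]→L[ℝ] ℂ} (hα : α ∈ primitiveForms η k) :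
    GForm.of k α ∈ HasLefschetzProperty.primitiveSpace (countingG E) (lefschetzG η) n :=
  (of_mem_primitiveSpace_iff_lefschetzDualG_eq_zero hη hkn α).2 (lefschetzDualG_of_of_mem_primitiveForms hη (by omega) hα)

/-- **`of k α ∈ P_{−n} ⟺ α ∈ Pᵏ(η)`** (`k + n = g`): the abstract lowest-weight space of the Lefschetz module `H•(X; ℂ)` in weight `−n`
meets `Hᵏ` exactly in Lange's/Voisin's primitive forms (`⇐` above; `⇒`: `Λ_η α = 0` and Voisin's Lemma 6.24 in degrees `≥ 2`, everything
is primitive in degrees `≤ 1`). [cite: Beauville2010SL2, §5 (p. 6)] [cite: Voisin2002, §6.2.2 Lemma 6.24] [cite: Lange2023AbelianVarietiesComplex, §7.3.2] -/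
theorem of_mem_primitiveSpace_iff_mem_primitiveForms (hη : ∀ v : E, v ≠ 0 → ∃ w : E, η ![v, w] ≠ 0) {k n : ℕ}
    (hkn : k + n = finrank ℂ E) (α : E [⋀^Fin k]→L[ℝ] ℂ) :
    GForm.of k α ∈ HasLefschetzProperty.primitiveSpace (countingG E) (lefschetzG η) n ↔ α ∈ primitiveForms η k := by
  refine ⟨fun h ↦ ?_, of_mem_primitiveSpace_of_mem_primitiveForms hη hkn⟩
  have h0 := (of_mem_primitiveSpace_iff_lefschetzDualG_eq_zero hη hkn α).1 h
  match k, hkn, α, h0 with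
  | 0, _, α, _ => rw [primitiveForms_eq_top_of_le_one η (by omega)]; exact Submodule.mem_top
  | 1, _, α, _ => rw [primitiveForms_eq_top_of_le_one η (by omega)]; exact Submodule.mem_top
  | m + 2, hkn, α, h0 =>
    rw [lefschetzDualG_of_add_two, GForm.of_eq_zero_iff] at h0
    exact mem_primitiveForms_of_lefschetzDual_eq_zero hη (by omega) h0

end Bridge

/-! ## §2 The Weyl operator on a string: `w(Lʲα/j!) = (−1)^r Lʳα/r!` -/

section Weyl

variable {E : Type uE} [NormedAddCommGroup E] [NormedSpace ℂ E] [FiniteDimensional ℂ E] [Nontrivial E] {η : E [⋀^Fin 2]→L[ℝ] ℝ}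

/-- **`w(Lʲα) = (−1)^{n+j} (j!/r!) · Lʳα`** for a primitive form `α ∈ Pᵏ(η)`, `k + n = g`, `j + r = n` (the abstract string formula
`w (eʲ p) = (−1)^{n+j} (j!/(n−j)!) e^{n−j} p` read on `H•(X; ℂ)`; degrees `2j + k = a`, `2r + k = b` free).
[cite: Beauville2010SL2, §5 Corollary (p. 6)] [cite: Andre1996Motifs, §1.2 (p. 11)] -/
theorem weylOperator_of_lefschetzPow_of_mem_primitiveForms (hη : ∀ v : E, v ≠ 0 → ∃ w : E, η ![v, w] ≠ 0) {k n : ℕ}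
    (hkn : k + n = finrank ℂ E) {α : E [⋀^Fin k]→L[ℝ] ℂ} (hα : α ∈ primitiveForms η k) {j r : ℕ} (hjr : j + r = n) {a b : ℕ}
    (ha : 2 * j + k = a) (hb : 2 * r + k = b) :
    (hasLefschetzProperty_lefschetzG hη).weylOperator isZGrading_countingG (GForm.of a (lefschetzPow η j ha α)) =
      ((-1 : ℂ) ^ (n + j) * ((j.factorial : ℕ) : ℂ) * ((r.factorial : ℕ) : ℂ)⁻¹) • GForm.of b (lefschetzPow η r hb α) := by
  rw [← lefschetzG_pow_of η j ha α, (hasLefschetzProperty_lefschetzG hη).weylOperator_apply_pow_primitive isZGrading_countingG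
    (of_mem_primitiveSpace_of_mem_primitiveForms hη hkn hα) (show j ≤ n by omega), show n - j = r by omega, lefschetzG_pow_of η r hb α]

omit [FiniteDimensional ℂ E] [Nontrivial E] in
/-- `(−1)^{n+j} = (−1)^r` for `j + r = n`. [folklore] -/
private theorem neg_one_pow_add_eq₆₂ {n j r : ℕ} (hjr : j + r = n) : (-1 : ℂ) ^ (n + j) = (-1) ^ r := by
  rw [← hjr, show j + r + j = r + 2 * j by omega, pow_add, pow_mul, neg_one_sq, one_pow, mul_one]

/-- **BEAUVILLE'S COROLLARY FOR THE WEYL ELEMENT: `w(Lʲα/j!) = (−1)^r · Lʳα/r!`** — "`ℱ(θ^q/q! · z) = ((−θ)^r/r!) z` with `r = g+s−2p−q`"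
for `z` primitive, `ℱ = ρ(0 −1 ; 1 0)` (here `α ∈ Pᵏ(η)`, `k + n = g`, `j + r = n`; the tree's `w` is `ρ(0 −1 ; 1 0)`, row g51-#9).
[cite: Beauville2010SL2, §5 Corollary (p. 6) and §4 Theorem ("(0 −1 ; 1 0)·z = ℱ(z)")] -/
theorem weylOperator_of_inv_factorial_smul_lefschetzPow (hη : ∀ v : E, v ≠ 0 → ∃ w : E, η ![v, w] ≠ 0) {k n : ℕ}
    (hkn : k + n = finrank ℂ E) {α : E [⋀^Fin k]→L[ℝ] ℂ} (hα : α ∈ primitiveForms η k) {j r : ℕ} (hjr : j + r = n) {a b : ℕ}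
    (ha : 2 * j + k = a) (hb : 2 * r + k = b) :
    (hasLefschetzProperty_lefschetzG hη).weylOperator isZGrading_countingG (GForm.of a (((j.factorial : ℕ) : ℂ)⁻¹ • lefschetzPow η j ha α)) =
      ((-1 : ℂ) ^ r) • GForm.of b (((r.factorial : ℕ) : ℂ)⁻¹ • lefschetzPow η r hb α) := by
  have hj : ((j.factorial : ℕ) : ℂ) ≠ 0 := Nat.cast_ne_zero.2 (Nat.factorial_ne_zero j)
  rw [GForm.of_smul, map_smul, weylOperator_of_lefschetzPow_of_mem_primitiveForms hη hkn hα hjr ha hb, smul_smul, GForm.of_smul,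
    smul_smul, neg_one_pow_add_eq₆₂ hjr]
  congr 1
  field_simp

/-- **The bottom of the string: `w(α) = (−1)^n · Lⁿα/n!`** for `α ∈ Pᵏ(η)`, `k + n = g` (`j = 0`; Bourbaki's `θ(t) e_n = (−1)^n e^{(n)}_0`-type
end formula). [cite: Beauville2010SL2, §5 Corollary (p. 6), q = 0] [cite: Andre1996Motifs, §1.2 (p. 11)] -/
theorem weylOperator_of_of_mem_primitiveForms (hη : ∀ v : E, v ≠ 0 → ∃ w : E, η ![v, w] ≠ 0) {k n : ℕ} (hkn : k + n = finrank ℂ E)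
    {α : E [⋀^Fin k]→L[ℝ] ℂ} (hα : α ∈ primitiveForms η k) {b : ℕ} (hb : 2 * n + k = b) :
    (hasLefschetzProperty_lefschetzG hη).weylOperator isZGrading_countingG (GForm.of k α) =
      ((-1 : ℂ) ^ n * ((n.factorial : ℕ) : ℂ)⁻¹) • GForm.of b (lefschetzPow η n hb α) := by
  have h := weylOperator_of_lefschetzPow_of_mem_primitiveForms hη hkn hα (zero_add n) (show 2 * 0 + k = k by omega) hb
  rwa [lefschetzPow_zero_apply, add_zero, Nat.factorial_zero, Nat.cast_one, mul_one] at h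

/-- **The top of the string: `w(Lⁿα) = n! · α`** for `α ∈ Pᵏ(η)`, `k + n = g`. [cite: Beauville2010SL2, §5 Corollary (p. 6), q = g+s−2p]
[cite: Andre1996Motifs, §1.2 (p. 11)] -/
theorem weylOperator_of_lefschetzPow_top (hη : ∀ v : E, v ≠ 0 → ∃ w : E, η ![v, w] ≠ 0) {k n : ℕ} (hkn : k + n = finrank ℂ E)
    {α : E [⋀^Fin k]→L[ℝ] ℂ} (hα : α ∈ primitiveForms η k) {a : ℕ} (ha : 2 * n + k = a) :
    (hasLefschetzProperty_lefschetzG hη).weylOperator isZGrading_countingG (GForm.of a (lefschetzPow η n ha α)) =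
      ((n.factorial : ℕ) : ℂ) • GForm.of k α := by
  rw [weylOperator_of_lefschetzPow_of_mem_primitiveForms hη hkn hα (add_zero n) ha (show 2 * 0 + k = k by omega), lefschetzPow_zero_apply,
    ← two_mul, pow_mul, neg_one_sq, one_pow, one_mul, Nat.factorial_zero, Nat.cast_one, inv_one, mul_one]

end Weyl

/-! ## §3 The Fourier transform on a string: `φ^*F(Lʲα/j!) = (−1)^g χ(d) · (−1)^r Lʳα/r!` -/

section Fourier

variable {ι : Type*} [Fintype ι] [DecidableEq ι] {E : Type uE} [NormedAddCommGroup E] [NormedSpace ℂ E] [FiniteDimensional ℂ E]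
  [Nontrivial E] (Φ : (ι → ℝ) ≃L[ℝ] E) {η : E [⋀^Fin 2]→L[ℝ] ℝ} {N : ℕ}

/-- **`φ^*F(Lʲα) = (−1)^g χ(d) · (−1)^{n+j} (j!/r!) · Lʳα`** for `α ∈ Pᵏ(η)`, `η` a Riemann form of type `d = (d₁, …, d_g)`, `k + n = g`,
`j + r = n`, as forms of degree `b = 2r + k` (`a + b = 2g`, `a = 2j + k`): row g51-#4 `φ^* ∘ F = (−1)^g χ(d) · w` and §2.
[cite: Beauville2010SL2, §5 Corollary (p. 6)] [cite: Polishchuk2007FourierStable, §1 Lemma 1.4 (p. 3)] [cite: Lange2023AbelianVarietiesComplex, §6.2.4 Prop. 6.2.20 p. 310] -/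
theorem IsPolarizationType.fourierForm_lefschetzPow_compContinuousLinearMap (hR : IsRiemannForm Φ η) {g : ℕ} {d : Fin g → ℕ}
    (hd : IsPolarizationType Φ η d) (hη : ∀ v : E, v ≠ 0 → ∃ w : E, η ![v, w] ≠ 0) (φ : E →L[ℝ] (E →L⋆[ℂ] ℂ))
    (hφ : ∀ u w, (φ u w).im = η ![u, w]) (e : Fin N ≃ ι) {k n : ℕ} (hkn : k + n = finrank ℂ E) {α : E [⋀^Fin k]→L[ℝ] ℂ}
    (hα : α ∈ primitiveForms η k) {j r : ℕ} (hjr : j + r = n) {a b : ℕ} (ha : 2 * j + k = a) (hb : 2 * r + k = b) (hab : a + b = N) :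
    (fourierForm Φ e hab (lefschetzPow η j ha α)).compContinuousLinearMap φ =
      ((-1 : ℂ) ^ g * (∏ i, (d i : ℂ)) * ((-1 : ℂ) ^ (n + j) * ((j.factorial : ℕ) : ℂ) * ((r.factorial : ℕ) : ℂ)⁻¹)) • lefschetzPow η r hb α := by
  apply GForm.of_injective b
  rw [hd.of_fourierForm_compContinuousLinearMap Φ hR hη φ hφ e hab, weylOperator_of_lefschetzPow_of_mem_primitiveForms hη hkn hα hjr ha hb,
    smul_smul, GForm.of_smul]

/-- **BEAUVILLE'S COROLLARY FOR LANGE'S FOURIER TRANSFORM: `φ^*F(Lʲα/j!) = (−1)^g χ(d) · (−1)^r · Lʳα/r!`** (`α ∈ Pᵏ(η)`, `k + n = g`,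
`j + r = n`, degrees `a = 2j + k`, `b = 2r + k`, `a + b = 2g`): the Fourier transform moves along the `𝔰𝔩₂`-string of a primitive class,
exchanging the divided powers `η^{∧j}/j!` and `(−η)^{∧r}/r!`, up to Polishchuk's normalisation `(−1)^g χ(d)` of `φ^* ∘ F` against `w`.
[cite: Beauville2010SL2, §5 Corollary (p. 6)] [cite: Polishchuk2007FourierStable, §1 Lemma 1.4 (p. 3)] [cite: Lange2023AbelianVarietiesComplex, §6.2.4 Prop. 6.2.20 p. 310] -/
theorem IsPolarizationType.fourierForm_inv_factorial_smul_lefschetzPow_compContinuousLinearMap (hR : IsRiemannForm Φ η) {g : ℕ}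
    {d : Fin g → ℕ} (hd : IsPolarizationType Φ η d) (hη : ∀ v : E, v ≠ 0 → ∃ w : E, η ![v, w] ≠ 0) (φ : E →L[ℝ] (E →L⋆[ℂ] ℂ))
    (hφ : ∀ u w, (φ u w).im = η ![u, w]) (e : Fin N ≃ ι) {k n : ℕ} (hkn : k + n = finrank ℂ E) {α : E [⋀^Fin k]→L[ℝ] ℂ}
    (hα : α ∈ primitiveForms η k) {j r : ℕ} (hjr : j + r = n) {a b : ℕ} (ha : 2 * j + k = a) (hb : 2 * r + k = b) (hab : a + b = N) :
    (fourierForm Φ e hab (((j.factorial : ℕ) : ℂ)⁻¹ • lefschetzPow η j ha α)).compContinuousLinearMap φ =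
      ((-1 : ℂ) ^ g * (∏ i, (d i : ℂ)) * (-1 : ℂ) ^ r) • (((r.factorial : ℕ) : ℂ)⁻¹ • lefschetzPow η r hb α) := by
  apply GForm.of_injective b
  rw [hd.of_fourierForm_compContinuousLinearMap Φ hR hη φ hφ e hab, weylOperator_of_inv_factorial_smul_lefschetzPow hη hkn hα hjr ha hb,
    smul_smul, GForm.of_smul, GForm.of_smul, GForm.of_smul]

omit [Fintype ι] [DecidableEq ι] [FiniteDimensional ℂ E] [Nontrivial E] in
/-- `(−1)^g (−1)^n = (−1)^k` for `k + n = g`. [folklore] -/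
private theorem neg_one_pow_mul_neg_one_pow_eq₆₂ {k n g : ℕ} (hkn : k + n = g) : (-1 : ℂ) ^ g * (-1) ^ n = (-1) ^ k := by
  rw [← hkn, pow_add, mul_assoc, ← pow_add, ← two_mul, pow_mul, neg_one_sq, one_pow, mul_one]

/-- **THE FOURIER TRANSFORM OF A PRIMITIVE CLASS IS ITS LEFSCHETZ-DUAL TOP: `φ^*F(α) = (−1)^k χ(d) · Lⁿα/n!`** for `α ∈ Pᵏ(η)` primitive of
degree `k`, `k + n = g` (`j = 0`: `(−1)^g (−1)^n = (−1)^k`). For `α = 1 ∈ H⁰` this is row g50-#2's `F(1) = (−1)^g χ(d)·γ̂_g`-type formula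
(`φ^*F(1) = χ(d) · ηᵍ/g!`); here for every primitive class in every degree.
[cite: Beauville2010SL2, §5 Corollary (p. 6), q = 0] [cite: Lange2023AbelianVarietiesComplex, §6.2.4 Prop. 6.2.20 p. 310; Lemma 6.2.19 p. 309] -/
theorem IsPolarizationType.fourierForm_compContinuousLinearMap_of_mem_primitiveForms (hR : IsRiemannForm Φ η) {g : ℕ}
    {d : Fin g → ℕ} (hd : IsPolarizationType Φ η d) (hη : ∀ v : E, v ≠ 0 → ∃ w : E, η ![v, w] ≠ 0) (φ : E →L[ℝ] (E →L⋆[ℂ] ℂ))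
    (hφ : ∀ u w, (φ u w).im = η ![u, w]) (e : Fin N ≃ ι) {k n : ℕ} (hkn : k + n = finrank ℂ E) {α : E [⋀^Fin k]→L[ℝ] ℂ}
    (hα : α ∈ primitiveForms η k) {b : ℕ} (hb : 2 * n + k = b) (hkb : k + b = N) :
    (fourierForm Φ e hkb α).compContinuousLinearMap φ = ((-1 : ℂ) ^ k * (∏ i, (d i : ℂ)) * ((n.factorial : ℕ) : ℂ)⁻¹) • lefschetzPow η n hb α := by
  have hcard : Fintype.card ι = N := by simpa using (Fintype.card_congr e).symm
  have hg : g = finrank ℂ E := by have := hd.card_eq; have := finrank_complex_mul_two Φ e; omega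
  apply GForm.of_injective b
  rw [hd.of_fourierForm_compContinuousLinearMap Φ hR hη φ hφ e hkb, weylOperator_of_of_mem_primitiveForms hη hkn hα hb, smul_smul,
    GForm.of_smul, show (-1 : ℂ) ^ g * (∏ i, (d i : ℂ)) * ((-1) ^ n * ((n.factorial : ℕ) : ℂ)⁻¹) =
      (-1 : ℂ) ^ g * (-1) ^ n * (∏ i, (d i : ℂ)) * ((n.factorial : ℕ) : ℂ)⁻¹ by ring, neg_one_pow_mul_neg_one_pow_eq₆₂ (hg ▸ hkn)]

/-- **`φ^*F(Lⁿα) = (−1)^g χ(d) · n! · α`** for `α ∈ Pᵏ(η)`, `k + n = g`: the Fourier transform sends the top of the string of a primitive class to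
a multiple of the class itself. [cite: Beauville2010SL2, §5 Corollary (p. 6), q = g+s−2p] [cite: Lange2023AbelianVarietiesComplex, §6.2.4 Prop. 6.2.20 p. 310] -/
theorem IsPolarizationType.fourierForm_lefschetzPow_top_compContinuousLinearMap (hR : IsRiemannForm Φ η) {g : ℕ} {d : Fin g → ℕ}
    (hd : IsPolarizationType Φ η d) (hη : ∀ v : E, v ≠ 0 → ∃ w : E, η ![v, w] ≠ 0) (φ : E →L[ℝ] (E →L⋆[ℂ] ℂ))
    (hφ : ∀ u w, (φ u w).im = η ![u, w]) (e : Fin N ≃ ι) {k n : ℕ} (hkn : k + n = finrank ℂ E) {α : E [⋀^Fin k]→L[ℝ] ℂ}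
    (hα : α ∈ primitiveForms η k) {a : ℕ} (ha : 2 * n + k = a) (hak : a + k = N) :
    (fourierForm Φ e hak (lefschetzPow η n ha α)).compContinuousLinearMap φ = ((-1 : ℂ) ^ g * (∏ i, (d i : ℂ)) * ((n.factorial : ℕ) : ℂ)) • α := by
  apply GForm.of_injective k
  rw [hd.of_fourierForm_compContinuousLinearMap Φ hR hη φ hφ e hak, weylOperator_of_lefschetzPow_top hη hkn hα ha, smul_smul, GForm.of_smul]

/-- **Principal polarisation, `φ = φ_H`: `φ_H^*F(Lʲα/j!) = (−1)^g · (−1)^r · Lʳα/r!`** (`χ = 1`, `g = dim_ℂ X`; `α ∈ Pᵏ(η)`, `k + n = g`,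
`j + r = n`). [cite: Beauville2010SL2, §5 Corollary (p. 6)] [cite: Polishchuk2007FourierStable, §1 Lemma 1.4 (p. 3)] -/
theorem IsPrincipalPolarization.fourierForm_inv_factorial_smul_lefschetzPow_comp_phiHRep (hp : IsPrincipalPolarization Φ η)
    (hη : ∀ v : E, v ≠ 0 → ∃ w : E, η ![v, w] ≠ 0) (e : Fin N ≃ ι) {k n : ℕ} (hkn : k + n = finrank ℂ E) {α : E [⋀^Fin k]→L[ℝ] ℂ}
    (hα : α ∈ primitiveForms η k) {j r : ℕ} (hjr : j + r = n) {a b : ℕ} (ha : 2 * j + k = a) (hb : 2 * r + k = b) (hab : a + b = N) :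
    (fourierForm Φ e hab (((j.factorial : ℕ) : ℂ)⁻¹ • lefschetzPow η j ha α)).compContinuousLinearMap
        ((phiHRep Φ hp.isRiemannForm.1).restrictScalars ℝ) =
      ((-1 : ℂ) ^ finrank ℂ E * (-1 : ℂ) ^ r) • (((r.factorial : ℕ) : ℂ)⁻¹ • lefschetzPow η r hb α) := by
  obtain ⟨g, d, hd, h1⟩ := hp.exists_type_eq_one
  have hcard : Fintype.card ι = N := by simpa using (Fintype.card_congr e).symm
  have hg : g = finrank ℂ E := by have := hd.card_eq; have := finrank_complex_mul_two Φ e; omega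
  subst hg
  rw [hd.fourierForm_inv_factorial_smul_lefschetzPow_compContinuousLinearMap Φ hp.isRiemannForm hη _ (fun u w ↦ im_phiHFun η u w) e hkn
    hα hjr ha hb hab]
  simp [h1]

/-- **Principal polarisation: `φ_H^*F(α) = (−1)^k · Lⁿα/n!` for a primitive class `α` of degree `k`**, `k + n = g` — on a principally
polarised abelian variety the Fourier transform of a primitive class is (up to sign) its minimal-class multiple `θ^{∧n}/n! ∧ α`.
[cite: Beauville2010SL2, §5 Corollary (p. 6), q = 0] [cite: Lange2023AbelianVarietiesComplex, §6.2.4 Prop. 6.2.20 p. 310] -/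
theorem IsPrincipalPolarization.fourierForm_comp_phiHRep_of_mem_primitiveForms (hp : IsPrincipalPolarization Φ η)
    (hη : ∀ v : E, v ≠ 0 → ∃ w : E, η ![v, w] ≠ 0) (e : Fin N ≃ ι) {k n : ℕ} (hkn : k + n = finrank ℂ E) {α : E [⋀^Fin k]→L[ℝ] ℂ}
    (hα : α ∈ primitiveForms η k) {b : ℕ} (hb : 2 * n + k = b) (hkb : k + b = N) :
    (fourierForm Φ e hkb α).compContinuousLinearMap ((phiHRep Φ hp.isRiemannForm.1).restrictScalars ℝ) =
      ((-1 : ℂ) ^ k * ((n.factorial : ℕ) : ℂ)⁻¹) • lefschetzPow η n hb α := by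
  obtain ⟨g, d, hd, h1⟩ := hp.exists_type_eq_one
  rw [hd.fourierForm_compContinuousLinearMap_of_mem_primitiveForms Φ hp.isRiemannForm hη _ (fun u w ↦ im_phiHFun η u w) e hkn hα hb hkb]
  simp [h1]

end Fourier

end ComplexTorus

end Literature.Geometry.Kaehler

end
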